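import Literature.Analysis.FunctionSpaces.TorusTestFunction
import Literature.Analysis.FunctionSpaces.TorusSobolevNorm
import Literature.Analysis.FunctionSpaces.Complexify
import HarnessLib

/-!
# The `h`-principle for weak stationary Euler flows on `T^d` (Choffrut–Székelyhidi 2014)

Topic `Literature/Analysis/FluidPDE` (fluid PDE on the flat unit torus, in the coordinates of
`Literature.Analysis.FunctionSpaces.Torus.*`: `IsSmooth`, `IsDivFree`, `convect`, `gradient`,
`IsWeaklyDivFree`, the spectral Sobolev scale `eSobolevNorm`, and `EuclideanSpace.complexify` to feed
real vector fields into the complex Fourier machinery, as in `BuckmasterVicol.lean`).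

One NAMED FACT (D-0014; a `def … : Prop`, taken by users as a hypothesis `(h : …)`):

* `ChoffrutSzekelyhidi2014_thm1` — **Choffrut–Székelyhidi 2014, Theorem 1** (SIAM J. Math. Anal.
  46 (2014) 4060–4074 = arXiv:1401.4301, Thm. 1 on p. 3 of the arXiv version, read there): let
  `d ≥ 2`, let `v₀` be a smooth stationary Euler flow on `T^d` (a smooth solution of
  `(v·∇)v + ∇p = 0`, `div v = 0`, with smooth pressure `p₀` — Step 2 of the printed proof, p. 5) and
  let `e` be a smooth function with `e(x) > |v₀(x)|²` on `T^d`. Then for every `σ > 0` there exist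
  infinitely many weak stationary flows `v ∈ L^∞(T^d; ℝ^d)` with `|v(x)|² = e(x)` for a.e. `x` and
  `‖v − v₀‖_{H⁻¹(T^d)} < σ`. Here (p. 3) `v ∈ L^∞` is a weak solution iff
  `∫ v ⊗ v : ∇Φ dx = 0` for every smooth divergence-free `Φ` and `∫ v · ∇f dx = 0` for every smooth
  scalar `f`; in the tree's notation `v ⊗ v : ∇Φ = ⟪v, (v·∇)Φ⟫ = ⟪v x, Torus.convect v Φ x⟫` (the
  unforced, inviscid case of the weak form used by `Torus.IsWeakNSSolutionOn` and by the route item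
  `SteadyWeakLimit.StandingCascadeExists`), and the second condition is `Torus.IsWeaklyDivFree v`.

## Rendering choices

* "Infinitely many" is rendered junk-free as: for every `n` there are `n` such flows, pairwise NOT
  a.e. equal (all clauses are invariant under a.e. modification, so `Set.Infinite` over raw
  functions would collapse to mere existence).
* The `H⁻¹` distance is the tree's inhomogeneous spectral norm `Torus.eSobolevNorm (-1)` of the
  complexified difference, compared in `ℝ≥0∞` with `ENNReal.ofReal σ` (no `toReal` junk; `v ∈ L^∞`
  on the probability space `T^d` is integrable, so the Fourier coefficients are genuine). The paper's
  torus/normalisation of `H⁻¹` may differ from the unit torus by constants; since the statement is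
  "for every `σ > 0`" (and, p. 3, "the approximation can be taken in any negative Sobolev norm"),
  this is immaterial.
* `d` is any finite index type with `2 ≤ Fintype.card d` (the tree's torus API is stated over an
  index type `d`).

Grounds (as nearest print, unforced case) the route item
`Summit.AnomalousDissipation.AnomalousDissipation.Theses.SteadyWeakLimit.StandingCascadeExists`
(stmt-AnomalousDissipation-1309, which asks for the FORCED analogue with an external source `f`, not
in print), and is the stationary convex-integration input cited by the Theses files `LandauJetArena`,
`DSolutionBubble`, `GaldiLiouvilleGate`.

## Not vendored

The 2-d rigidity remark (the stationary relaxation in `d = 2` is strictly smaller than the convex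
hull, §4 of the paper) and the `L^∞` pressure remark are not stated. No proof is attempted
(stationary convex integration; cf. the tree's `ConvexIntegration2D*` files for the time-dependent
planar machinery).

## References

* A. Choffrut, L. Székelyhidi Jr., *Weak solutions to the stationary incompressible Euler
  equations*, SIAM J. Math. Anal. 46 (2014), no. 6, 4060–4074; arXiv:1401.4301, Theorem 1 (p. 3),
  proof Step 2 (p. 5). [ChoffrutSzekelyhidi2014]
* C. De Lellis, L. Székelyhidi Jr., *The Euler equations as a differential inclusion*, Ann. of
  Math. 170 (2009), §1 (weak solutions). [LellisSzekelyhidi2009]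
-/

noncomputable section

open _root_.MeasureTheory
open scoped InnerProductSpace ENNReal

namespace Literature.Analysis.FluidPDE

namespace Torus

open Literature.Analysis.FunctionSpaces

/-- **Choffrut–Székelyhidi 2014, Theorem 1 (h-principle for weak stationary Euler flows).**
Let `d ≥ 2`, let `(v₀, p₀)` be a smooth stationary Euler flow on `T^d`
(`(v₀·∇)v₀ + ∇p₀ = 0`, `div v₀ = 0`) and let `e` be smooth with `e(x) > |v₀(x)|²` for all `x`.
Then for every `σ > 0` there are infinitely many (here: for every `n`, `n` pairwise not-a.e.-equal)
weak stationary flows `v ∈ L^∞(T^d; ℝ^d)` — `∫ ⟪v, (v·∇)w⟫ = 0` for every smooth divergence-free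
`w` and `∫ ⟪v, ∇θ⟫ = 0` for every smooth `θ` — with `|v(x)|² = e(x)` for a.e. `x` and
`‖v − v₀‖_{H⁻¹(T^d)} < σ`. [cite: ChoffrutSzekelyhidi2014, Thm. 1] -/
def ChoffrutSzekelyhidi2014_thm1 : Prop :=
  ∀ (d : Type) [Fintype d] [DecidableEq d], 2 ≤ Fintype.card d →
    ∀ (v₀ : UnitAddTorus d → EuclideanSpace ℝ d) (p₀ : UnitAddTorus d → ℝ)
      (e : UnitAddTorus d → ℝ),
      Torus.IsSmooth v₀ → Torus.IsSmooth p₀ → Torus.IsDivFree v₀ →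
      (∀ x, Torus.convect v₀ v₀ x + Torus.gradient p₀ x = 0) →
      Torus.IsSmooth e → (∀ x, ‖v₀ x‖ ^ 2 < e x) →
      ∀ σ : ℝ, 0 < σ → ∀ n : ℕ,
        ∃ v : Fin n → UnitAddTorus d → EuclideanSpace ℝ d,
          (∀ i j, i ≠ j → ¬ (v i =ᵐ[volume] v j)) ∧
          ∀ i, MemLp (v i) ∞ volume ∧ Torus.IsWeaklyDivFree (v i) ∧
            (∀ w : UnitAddTorus d → EuclideanSpace ℝ d, Torus.IsSmooth w → Torus.IsDivFree w →
              ∫ x, ⟪v i x, Torus.convect (v i) w x⟫_ℝ = 0) ∧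
            (∀ᵐ x ∂volume, ‖v i x‖ ^ 2 = e x) ∧
            Torus.eSobolevNorm (-1) (EuclideanSpace.complexify ∘ fun x => v i x - v₀ x) <
              ENNReal.ofReal σ

end Torus

end Literature.Analysis.FluidPDE
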